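import Summits.ResolutionOfSingularities.ResolutionOfSingularities.Theorems.PurelyInseparableDim4ResConeCInfSharpEntryOfChainPrime
import Summits.ResolutionOfSingularities.ResolutionOfSingularities.Theorems.PurelyInseparableDim4ResConeCInfSharpFlagPrime
import Summits.ResolutionOfSingularities.ResolutionOfSingularities.Theorems.PurelyInseparableDim4SwapTransportTranslatedChainSigma
import Summits.ResolutionOfSingularities.ResolutionOfSingularities.Theorems.PurelyInseparableDim4ResConeCInfSharpChainSigma
import HarnessLib
import HarnessLib.Audit.Tags

/-!
# Purely inseparable four-folds — THE FLAGLESS BRANCH OF A σ = (n, n) + 0 POWER-CONE CHAIN DIES AT REGIME R, every prime with `d ≤ n + 4`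
# (NO window): the σ-edition of the ♯-entry E5♯ with the ♯-window replaced by «a regime-R σ-state is never isolated»
# (cell `res-dim4-pi`, K2(p) lane, class (iii) rows σ = (2,2)+0, (3,3)+0 of K2(7), flagless branch, (σ♭) FILE E5σ♭)

[OURS · counted 0 · cell `res-dim4-pi` · K2(p) lane (holder res-dim4-p-12 g5, ruling g5-33 «(σ♭) GO; E5σ♭ + DICHOTOMYσ = res-dim4-p-3»); seat
res-dim4-p-3 g6.]  Nothing here proves K2(p) for any `p`, any TAIL(p, d, 3), `NoIsolatedTrap p p`, the Cossart–Jannsen–Saito theorem or resolution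
of singularities in dimension ≥ 4 / characteristic `p` — NOT proved.  AI kernel work, weaker than expert review.  A CHAIN-LEVEL ASSEMBLY about
OUR frame.

SETTING (`n + d = p`, `0 < n`, `2 ≤ d`, `d ≤ n + 4`): an isolated above-floor witnessed Step0-`p` chain with `x^{r₀} ∣ F₀`, shade `d`, `e_G = 3`
and boundary of total weight `2n` from `k₀` (the class (iii) σ-chain of res-dim4-typ-1 g6's `SwapTransport.cInf_no_chain_of_entry_sigma0`), and
at a time `k′ ≥ k₀`, for cofinally many precisions `M`, the data of a framed child `C₁ = step p univ κ 0 S₂` related to `c (k′+1)` along a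
labelling `π₀` NAMING THE LEDGER (`(c (k′+1)).r = n·π₀λ + n·π₀μ`) whose u-row flags `coeff x^r x_λx_μx_u^{eu+1}x_f^{ef}` (`eu + ef = d − 2`)
ALL VANISH — the negation of the ledger-labelled per-chain σ-flag `hQcσ_r` (the hypothesis under which the FLAGGED branch is the σ-window's).
* §1 **`support_straight_of_resForm_sigma`**, **`framed_child_frame_sigma`**, **`reg_of_straight_sigma`** — the σ-editions of ♯8-tools §2 and of
  res-dim4-typ-1 g6's `reg_of_straight` (over `coeff_resForm_eq_coeff_add` and res-dim4-typ-1 g6's TSσ `translated_child_frame_sigma` at `β = 0`).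
* §2 **`cInf_no_chain_sigma0_of_not_chainFlag_r`** — THE FLAGLESS σ-BRANCH IS EMPTY: pigeonhole on `(λ, μ, u, f, π₀)` (E5♯ §1
  `exists_letters_frequently`); ♯8-tools `rel_comp_tsch` + §1 give the inputs of (I♭)σ `SwapTransport.exists_virtual_translated_chain_sigma0`; two
  satellites `k + t₀`, `k + t₁ ≥ k + t₀ + 4` (free-tail lemma) are virtual letter changes ((ℓ-sat)σ
  `SwapTransport.virtual_letter_change_of_satellite_of_regime_sigma0`, E5♯ §1 `virtual_data_ext`); res-dim4-p-13 g6's ♯8σ `sharp_chain_sigma`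
  gives slot exponents `≥ n` and REGIME R at `t₀ + 2`; ♯4 §5 `not_isIsolated_of_regimeR_sigma` (`d ≤ n + 4`) contradicts the isolation that
  (I♭)σ transports.  At `p = 7`: σ = (2,2)+0 (`d = 5`) and (3,3)+0 (`d = 4`).
[cite: CossartJannsenSaito2020, Thm. 3.14, Lemma 13.2] [cite: Hauser2010, §§F–G]
bears_on: LADDER-RESOLUTION:D157-DOOR2 (res-dim4-pi · K2(p) · power cones · class (iii) σ-rows flagless branch E5σ♭).  Supports
stmt-ResolutionOfSingularities-16155 (helper).
-/

set_option linter.dupNamespace false -- mandated namespace of this single-conjunct summit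

noncomputable section

namespace Summit.ResolutionOfSingularities.ResolutionOfSingularities.Theorems.PIDim4

namespace ResCone

open MvPolynomial Finset FrameChange
open Literature.AlgebraicGeometry.Resolution
open Literature.AlgebraicGeometry.Resolution.CentreBlowup
open Literature.AlgebraicGeometry.Resolution.Hauser2010
open Literature.AlgebraicGeometry.Resolution.HauserPerlega2019

variable {K : Type} [Field K] [DecidableEq K]

/-! ## 1. σ-tools: support-straightness, the framed child's frame, the regime in support form -/

omit [DecidableEq K] in
/-- **A straight residual cone pins the degree-`(p+n)` support, σ-edition** (`r = n·λ + n·μ`, `x^r ∣ F`, `ord₀ F = p + n`, `n + d = p`,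
`resForm = a·x_f^d` ⇒ every degree-`(p+n)` exponent is the σ-cone). [OURS · bookkeeping] -/
theorem support_straight_of_resForm_sigma {la mu u f : Fin 4} {n d p : ℕ} (hσ : n + d = p) {s : State K}
    (hr : s.r = Finsupp.single la n + Finsupp.single mu n)
    (hdiv : ∀ e ∈ s.F.support, s.r ≤ e) (ho : ordZero s.F = ((p + n : ℕ) : ℕ∞)) {a : K} (hres : resForm s = C a * X f ^ d) :
    ∀ e ∈ s.F.support, e.degree = p + n →
      e = Finsupp.single la n + Finsupp.single mu n + Finsupp.single u 0 + Finsupp.single f d := by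
  classical
  intro e he hdeg
  have hrdeg : s.r.degree = 2 * n := by rw [hr, map_add, Finsupp.degree_single, Finsupp.degree_single]; ring
  obtain ⟨m, rfl⟩ : ∃ m, e = s.r + m := ⟨e - s.r, (add_tsub_cancel_of_le (hdiv e he)).symm⟩
  have hm : m.degree = d := by rw [map_add, hrdeg] at hdeg; omega
  have hread : coeff m (resForm s) = coeff (s.r + m) s.F :=
    coeff_resForm_eq_coeff_add ho (by rw [hm, hrdeg]; omega) (by rw [hrdeg]; omega)
  have hne : coeff (s.r + m) s.F ≠ 0 := mem_support_iff.mp he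
  rw [← hread, hres, X_pow_eq_monomial, C_mul_monomial, mul_one, coeff_monomial] at hne
  by_cases hmf : Finsupp.single f d = m
  · rw [← hmf, hr, Finsupp.single_zero, add_zero]
  · exact absurd (if_neg hmf) hne

omit [DecidableEq K] in
/-- **The regime in support form, σ-edition**: order `p + n` and σ-support-straightness ⇒ every monomial has degree `≥ p + n + 1` or is the
σ-cone. [OURS · bookkeeping] -/
theorem reg_of_straight_sigma {la mu u f : Fin 4} {s : State K} {n d p : ℕ} (ho : ordZero s.F = ((p + n : ℕ) : ℕ∞))
    (hstraight : ∀ e ∈ s.F.support, e.degree = p + n →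
      e = Finsupp.single la n + Finsupp.single mu n + Finsupp.single u 0 + Finsupp.single f d) :
    ∀ E ∈ s.F.support, p + n + 1 ≤ E.degree ∨ E = Finsupp.single la n + Finsupp.single mu n + Finsupp.single u 0 + Finsupp.single f d := by
  intro E hE
  have h := le_degree_of_mem_support_of_ordZero ho hE
  rcases Nat.lt_or_ge E.degree (p + n + 1) with hlt | hge
  · exact Or.inr (hstraight E hE (by omega))
  · exact Or.inl hge

section Letters

variable {la mu u f : Fin 4} (hlm : la ≠ mu) (hlu : la ≠ u) (hlf : la ≠ f) (hmu : mu ≠ u) (hmf : mu ≠ f) (huf : u ≠ f)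
include hlm hlu hlf hmu hmf huf

/-- **THE FRAME OF THE FRAMED σ-CHILD** `C₁ = step p univ κ 0 S₂`, `κ ∈ {λ, μ}` (σ-edition of ♯8-tools `framed_child_frame_prime`, over
res-dim4-typ-1 g6's `translated_child_frame_sigma` at `β = 0`). [OURS · bookkeeping] [cite: Hauser2010, §§F–G] -/
theorem framed_child_frame_sigma (p : ℕ) [hp : Fact p.Prime] [CharP K p] {n d : ℕ} (hσ : n + d = p) (hn : 0 < n) (hd2 : 2 ≤ d)
    {κ : Fin 4} (hκ : κ = la ∨ κ = mu) {S₂ : State K} (hrS : S₂.r = Finsupp.single la n + Finsupp.single mu n)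
    (hdivS : ∀ e ∈ S₂.F.support, S₂.r ≤ e) (hoS : ordZero S₂.F = ((p + n : ℕ) : ℕ∞)) {a : K}
    (hresS : resForm S₂ = C a * X f ^ d) (hledS : ∀ e ∈ S₂.F.support, e f ≤ d - 1 → n + 1 ≤ e la ∧ n + 1 ≤ e mu)
    (hoC : ordZero (CentreBlowup.step p Finset.univ κ 0 S₂).F = ((p + n : ℕ) : ℕ∞))
    (he3C : Module.finrank K (resVertex (CentreBlowup.step p Finset.univ κ 0 S₂)) = 3) :
    (CentreBlowup.step p Finset.univ κ 0 S₂).r = Finsupp.single la n + Finsupp.single mu n ∧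
      (∀ e ∈ (CentreBlowup.step p Finset.univ κ 0 S₂).F.support, (CentreBlowup.step p Finset.univ κ 0 S₂).r ≤ e) ∧
      (∀ e ∈ (CentreBlowup.step p Finset.univ κ 0 S₂).F.support, e f ≤ d - 1 → n + 1 ≤ e la ∧ n + 1 ≤ e mu) ∧
      (∃ a' : K, a' ≠ 0 ∧ resForm (CentreBlowup.step p Finset.univ κ 0 S₂) = C a' * X f ^ d) ∧
      (∀ e ∈ (CentreBlowup.step p Finset.univ κ 0 S₂).F.support, e.degree = p + n →
        e = Finsupp.single la n + Finsupp.single mu n + Finsupp.single u 0 + Finsupp.single f d) := by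
  have hstraightS := support_straight_of_resForm_sigma (u := u) hσ hrS hdivS hoS hresS
  have h0 : Function.update (0 : Fin 4 → K) u 0 = 0 := Function.update_eq_self u (0 : Fin 4 → K)
  have hcone : (Finsupp.single la n + Finsupp.single mu n + Finsupp.single u 0 + Finsupp.single f d : Fin 4 →₀ ℕ) =
      Finsupp.single mu n + Finsupp.single la n + Finsupp.single u 0 + Finsupp.single f d := by
    rw [add_comm (Finsupp.single la n) (Finsupp.single mu n)]
  rcases hκ with h | h <;> rw [h] at hoC he3C ⊢
  · have H := translated_child_frame_sigma hlm hlu hlf hmu hmf huf p hσ hn hd2 hrS hdivS hoS hstraightS hledS (0 : K)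
      (by rw [h0]; exact hoC) (by rw [h0]; exact he3C)
    rw [h0] at H
    exact H
  · have hrS' : S₂.r = Finsupp.single mu n + Finsupp.single la n := by rw [hrS, add_comm]
    have hstraightS' : ∀ e ∈ S₂.F.support, e.degree = p + n →
        e = Finsupp.single mu n + Finsupp.single la n + Finsupp.single u 0 + Finsupp.single f d := fun e he hd =>
      (hstraightS e he hd).trans hcone
    have hledS' : ∀ e ∈ S₂.F.support, e f ≤ d - 1 → n + 1 ≤ e mu ∧ n + 1 ≤ e la := fun e he hef => (hledS e he hef).symm
    have H := translated_child_frame_sigma hlm.symm hmu hmf hlu hlf huf p hσ hn hd2 hrS' hdivS hoS hstraightS' hledS' (0 : K)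
      (by rw [h0]; exact hoC) (by rw [h0]; exact he3C)
    rw [h0] at H
    obtain ⟨hr', hdiv', hled', hres', hstr'⟩ := H
    exact ⟨by rw [hr', add_comm], hdiv', fun e he hef => (hled' e he hef).symm, hres',
      fun e he hd => (hstr' e he hd).trans hcone.symm⟩

end Letters

/-! ## 2. The flagless σ-branch is empty -/

/-- **THE FLAGLESS BRANCH OF A σ = (n, n) + 0 POWER-CONE CHAIN IS EMPTY** (`n + d = p`, `0 < n`, `2 ≤ d`, `d ≤ n + 4`; module docstring §2):
from the negation of the ledger-labelled per-chain σ-flag at a time `k′ ≥ k₀`, False. [OURS] [cite: CossartJannsenSaito2020, Thm. 3.14,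
Lemma 13.2] [cite: Hauser2010, §§F–G] -/
theorem cInf_no_chain_sigma0_of_not_chainFlag_r (p : ℕ) [hp : Fact p.Prime] [CharP K p] {n d : ℕ} (hσ : n + d = p) (hn : 0 < n)
    (hd2 : 2 ≤ d) (hdn : d ≤ n + 4) {c : ℕ → State K} {j : ℕ → Fin 4} {b : ℕ → Fin 4 → K}
    (hc : ∀ k, IsIsolated p (c k).F ∧ Step0 p (c k) (c (k + 1))) (hw : FreeTail.IsWitnessedChain p c j b)
    (hr0 : ∀ e ∈ (c 0).F.support, (c 0).r ≤ e) (hfloor : ∀ k, ordZero (c k).F ≠ (p : ℕ)) {k₀ : ℕ}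
    (hshade : ∀ k, k₀ ≤ k → (c k).shade = ((d : ℕ) : ℕ∞))
    (he3 : ∀ k, k₀ ≤ k → Module.finrank K (resVertex (c k)) = 3)
    (hwt : ∀ k, k₀ ≤ k → (c k).r.degree = 2 * n) {k' : ℕ} (hk' : k₀ ≤ k')
    (hnQ : ∀ M₀ : ℕ, ∃ M, M₀ ≤ M ∧ ∃ (la mu u f κ : Fin 4) (π₀ : Equiv.Perm (Fin 4)) (A₁ S₂ : State K)
        (Φ : MvPolynomial (Fin 4) K) (θ' e' : Fin 4 → MvPolynomial (Fin 4) K) (U' E' : MvPolynomial (Fin 4) K) (a : K),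
        la ≠ mu ∧ la ≠ u ∧ la ≠ f ∧ mu ≠ u ∧ mu ≠ f ∧ u ≠ f ∧ (κ = la ∨ κ = mu) ∧
        (c (k' + 1)).r = Finsupp.single (π₀ la) n + Finsupp.single (π₀ mu) n ∧
        θ' (π₀ la) = X la * e' la ∧ θ' (π₀ mu) = X mu * e' mu ∧ constantCoeff (e' la) ≠ 0 ∧ constantCoeff (e' mu) ≠ 0 ∧
        constantCoeff (θ' (π₀ u)) = 0 ∧ constantCoeff (θ' (π₀ f)) = 0 ∧
        coeff (Finsupp.single u 1) (θ' (π₀ u)) * coeff (Finsupp.single f 1) (θ' (π₀ f)) -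
          coeff (Finsupp.single f 1) (θ' (π₀ u)) * coeff (Finsupp.single u 1) (θ' (π₀ f)) ≠ 0 ∧
        constantCoeff U' ≠ 0 ∧ E' ∈ originIdeal K ^ M ∧ A₁.F = deletePthPowers p (U' ^ p * aeval θ' (c (k' + 1)).F) + E' ∧
        S₂.r = Finsupp.single la n + Finsupp.single mu n ∧ (∀ e ∈ S₂.F.support, S₂.r ≤ e) ∧
        ordZero S₂.F = ((p + n : ℕ) : ℕ∞) ∧ a ≠ 0 ∧ resForm S₂ = C a * X f ^ d ∧
        (∀ e ∈ S₂.F.support, e f ≤ d - 1 → n + 1 ≤ e la ∧ n + 1 ≤ e mu) ∧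
        f ∉ Φ.vars ∧ constantCoeff Φ = 0 ∧
        (CentreBlowup.step p Finset.univ κ 0 S₂).F = deletePthPowers p (tsch f Φ A₁.F) ∧
        ordZero (CentreBlowup.step p Finset.univ κ 0 S₂).F = ((p + n : ℕ) : ℕ∞) ∧
        IsIsolated p (CentreBlowup.step p Finset.univ κ 0 S₂).F ∧
        Module.finrank K (resVertex (CentreBlowup.step p Finset.univ κ 0 S₂)) = 3 ∧
        ∀ eu ef : ℕ, eu + ef = d - 2 →
          coeff ((CentreBlowup.step p Finset.univ κ 0 S₂).r +
            (Finsupp.single la 1 + Finsupp.single mu 1 + Finsupp.single u (eu + 1) + Finsupp.single f ef))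
            (CentreBlowup.step p Finset.univ κ 0 S₂).F = 0) : False := by
  classical
  -- the real chain in regime
  have hiso : ∀ k, IsIsolated p (c k).F := fun k => (hc k).1
  have ho6 : ∀ m, k₀ ≤ m → ordZero (c m).F = ((p + n : ℕ) : ℕ∞) := fun m hm => by
    obtain ⟨o, ho, -, -, hod⟩ := chain_shade_nat p hc hfloor hshade hm
    rw [hwt m hm] at hod
    have h6 : o = p + n := by omega
    rw [ho, h6]
  have hdiv : ∀ m, ∀ e ∈ (c m).F.support, (c m).r ≤ e := IsolatedBand.isolated_chain_forall_le hc hr0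
  have hcs : ∀ m, c (m + 1) = CentreBlowup.step p Finset.univ (j m) (b m) (c m) := fun m => (hw m).2.2.2.2
  set k : ℕ := k' + 1 with hk
  -- 1. the data, reshaped
  have hgood : ∀ M₀ : ℕ, ∃ M, M₀ ≤ M ∧ ∃ (la mu u f : Fin 4) (π₀ : Equiv.Perm (Fin 4)),
      la ≠ mu ∧ la ≠ u ∧ la ≠ f ∧ mu ≠ u ∧ mu ≠ f ∧ u ≠ f ∧
      (c k).r = Finsupp.single (π₀ la) n + Finsupp.single (π₀ mu) n ∧
      ∃ B₀ : State K, (∃ (θ e : Fin 4 → MvPolynomial (Fin 4) K) (U E : MvPolynomial (Fin 4) K),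
          θ (π₀ la) = X la * e la ∧ θ (π₀ mu) = X mu * e mu ∧ constantCoeff (e la) ≠ 0 ∧ constantCoeff (e mu) ≠ 0 ∧
          constantCoeff (θ (π₀ u)) = 0 ∧ constantCoeff (θ (π₀ f)) = 0 ∧
          coeff (Finsupp.single u 1) (θ (π₀ u)) * coeff (Finsupp.single f 1) (θ (π₀ f)) -
            coeff (Finsupp.single f 1) (θ (π₀ u)) * coeff (Finsupp.single u 1) (θ (π₀ f)) ≠ 0 ∧
          constantCoeff U ≠ 0 ∧ E ∈ originIdeal K ^ M ∧ B₀.F = deletePthPowers p (U ^ p * aeval θ (c k).F) + E) ∧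
        (ordZero B₀.F = ((p + n : ℕ) : ℕ∞) ∧ B₀.r = Finsupp.single la n + Finsupp.single mu n ∧
          (∀ e ∈ B₀.F.support, B₀.r ≤ e) ∧ (∃ a : K, a ≠ 0 ∧ resForm B₀ = C a * X f ^ d) ∧
          (∀ e ∈ B₀.F.support, e.degree = p + n →
            e = Finsupp.single la n + Finsupp.single mu n + Finsupp.single u 0 + Finsupp.single f d) ∧
          (∀ e ∈ B₀.F.support, e f ≤ d - 1 → n + 1 ≤ e la ∧ n + 1 ≤ e mu) ∧
          IsIsolated p B₀.F ∧ Module.finrank K (resVertex B₀) = 3) ∧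
        (∀ c' : ℕ, c' + 2 ≤ d →
          coeff (Finsupp.single la (n + 1) + Finsupp.single mu (n + 1) + Finsupp.single u (d - 1 - c') + Finsupp.single f c') B₀.F = 0) := by
    intro M₀
    obtain ⟨M, hM, la, mu, u, f, κ, π₀, A₁, S₂, Φ, θ', e', U', E', a, hlm, hlu, hlf, hmu, hmf, huf, hκ, hrA, h1, h2, h3, h4, h5,
      h6, h7, h8, h9, h10, hrS, hdivS, hoS, ha, hresS, hledS, hΦv, hΦ0, hC₁F, hoC, hisoC, he3C, hflagC⟩ := hnQ M₀
    obtain ⟨hrC, hdivC, hledC, ⟨a', ha', hresC⟩, hstrC⟩ :=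
      framed_child_frame_sigma hlm hlu hlf hmu hmf huf p hσ hn hd2 hκ hrS hdivS hoS hresS hledS hoC he3C
    refine ⟨M, hM, la, mu, u, f, π₀, hlm, hlu, hlf, hmu, hmf, huf, hrA, CentreBlowup.step p Finset.univ κ 0 S₂,
      rel_comp_tsch p hlm hlu hlf hmu hmf huf ⟨θ', e', U', E', h1, h2, h3, h4, h5, h6, h7, h8, h9, h10⟩ hΦv hΦ0 hC₁F,
      ⟨hoC, hrC, hdivC, ⟨a', ha', hresC⟩, hstrC, hledC, hisoC, he3C⟩, fun c' hc' => ?_⟩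
    have hexp : ((CentreBlowup.step p Finset.univ κ 0 S₂).r +
        (Finsupp.single la 1 + Finsupp.single mu 1 + Finsupp.single u (d - 2 - c' + 1) + Finsupp.single f c') : Fin 4 →₀ ℕ) =
        Finsupp.single la (n + 1) + Finsupp.single mu (n + 1) + Finsupp.single u (d - 1 - c') + Finsupp.single f c' := by
      rw [hrC]
      ext x
      simp only [Finsupp.coe_add, Pi.add_apply, Finsupp.single_apply]
      split_ifs <;> omega
    have h := hflagC (d - 2 - c') c' (by omega)
    rwa [hexp] at h
  -- 2. fix the letters and the labelling
  obtain ⟨la, mu, u, f, π₀, hfreq⟩ := exists_letters_frequently hgood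
  obtain ⟨-, -, hlm, hlu, hlf, hmu, hmf, huf, hrA0, -⟩ := hfreq 0
  -- 3. the recursion data (precision-independent)
  obtain ⟨πs, -, ℓs, hπ0, -, -, hℓs, hπs⟩ := SwapTransport.exists_virtual_data_prime p j b k la mu π₀ (c 0)
  have hℓ : ∀ t, ℓs t = la ∨ ℓs t = mu := SwapTransport.ℓs_eq_or hℓs
  -- 4. two satellites after `k`
  obtain ⟨s₀, hks₀, hsat₀⟩ := (FreeTail.satelliteRecurrenceAt_iff_noIsolatedFreeTailAt p p).mpr
    (FreeTailProof.noIsolatedFreeTailAt_self p) K c j b hw hiso k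
  obtain ⟨s₁, hks₁, hsat₁⟩ := (FreeTail.satelliteRecurrenceAt_iff_noIsolatedFreeTailAt p p).mpr
    (FreeTailProof.noIsolatedFreeTailAt_self p) K c j b hw hiso (s₀ + 4)
  obtain ⟨t₀, rfl⟩ : ∃ t₀, s₀ = k + t₀ := ⟨s₀ - k, by omega⟩
  obtain ⟨t₁, rfl⟩ : ∃ t₁, s₁ = k + t₁ := ⟨s₁ - k, by omega⟩
  have h01 : t₀ < t₁ := by omega
  set T : ℕ := t₁ + 2 with hT
  obtain ⟨Nc, hcert⟩ := SwapTransport.exists_common_cert_prime p (k := k) (T := T + 1) (fun t _ => hiso (k + t))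
  -- 5. the virtual chain at one sufficient precision
  obtain ⟨Mn, hMn, -, -, -, -, -, -, -, B₀, hrel0, hfr0, hflag0⟩ := hfreq (Nc + 2 * p + n + 1 + p * T)
  obtain ⟨πs', Bs, ℓs', βs, hπ0', hB0, hℓs', hπs', hstep, hpk⟩ :=
    SwapTransport.exists_virtual_translated_chain_sigma0 p hσ hn hd2 hlm hlu hlf hmu hmf huf hw (k := k) (Nc := Nc) (T := T)
      (fun t _ => hiso (k + t)) hcert (fun t _ => ho6 (k + t) (by omega)) (fun t _ => he3 (k + t) (by omega))
      (fun t _ => hwt (k + t) (by omega)) (fun t _ => hdiv (k + t)) hMn hrel0 hrA0 hfr0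
  obtain ⟨rfl, rfl⟩ := virtual_data_ext hℓs' hπs' hℓs hπs (hπ0'.trans hπ0.symm)
  -- letter changes at the two satellites
  have hchange : ∀ t, t + 1 ≤ T → FreeTail.IsSatellite j b (k + t) → ℓs' t ≠ ℓs' (t + 1) := by
    intro t ht hsat
    have hcs' : c (k + (t + 2)) = CentreBlowup.step p Finset.univ (j (k + (t + 1))) (b (k + (t + 1))) (c (k + (t + 1))) := by
      rw [show k + (t + 2) = k + (t + 1) + 1 by omega]; exact hcs _
    exact (SwapTransport.virtual_letter_change_of_satellite_of_regime_sigma0 p hn hlm hlu hlf hmu hmf huf hℓs' hπs'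
      (hpk (t + 1) (by omega)).2.1 (ho6 _ (by omega)) hcs' (hwt (k + (t + 2)) (by omega)) hsat).symm
  have hch₀ := hchange t₀ (by omega) hsat₀
  have hch₁ := hchange t₁ (by omega) hsat₁
  -- the chain theorem's inputs
  have hq : ∀ t, t ≤ T → ((p : ℕ) : ℕ∞) ≤ ordAlong Finset.univ (Bs t).F := fun t ht => by
    rw [ordAlong_univ, (hpk t (by omega)).2.2.1]; exact_mod_cast (by omega : p ≤ p + n)
  have hreg : ∀ t, t ≤ T → ∀ E ∈ (Bs t).F.support,
      p + n + 1 ≤ E.degree ∨ E = Finsupp.single la n + Finsupp.single mu n + Finsupp.single u 0 + Finsupp.single f d :=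
    fun t ht => reg_of_straight_sigma (hpk t (by omega)).2.2.1 (hpk t (by omega)).2.2.2.2.2.2.1
  obtain ⟨-, hrB0, hdivB0, -, -, hledB0, -, -⟩ := hfr0
  have hr1₀ : ∀ e ∈ (Bs 0).F.support, n ≤ e la ∧ n ≤ e mu := by
    rw [hB0]
    intro e he
    have h := Finsupp.le_def.mp (hdivB0 e he)
    have h1 := h la
    have h2 := h mu
    rw [hrB0, Finsupp.add_apply, Finsupp.single_eq_same, Finsupp.single_eq_of_ne hlm, add_zero] at h1
    rw [hrB0, Finsupp.add_apply, Finsupp.single_eq_of_ne hlm.symm, Finsupp.single_eq_same, zero_add] at h2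
    exact ⟨h1, h2⟩
  have hled₀ : ∀ e ∈ (Bs 0).F.support, e f ≤ d - 1 → n + 1 ≤ e la ∧ n + 1 ≤ e mu := by rw [hB0]; exact hledB0
  have hflag₀ : (∀ c' : ℕ, c' + 2 ≤ d →
        coeff (Finsupp.single la (n + 1) + Finsupp.single mu (n + 1) + Finsupp.single u (d - 1 - c') + Finsupp.single f c') (Bs 0).F = 0) := by
    rw [hB0]; exact hflag0
  -- ♯8σ: slot exponents ≥ n and regime R two steps after the first change
  obtain ⟨hr1e, -, hRe, -⟩ := sharp_chain_sigma hlm hlu hlf hmu hmf huf p hσ hd2 Bs ℓs' βs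
    (fun t ht => hstep t ht.le) hℓ hq hreg hr1₀ hled₀ hflag₀ h01 (by omega) hch₀ hch₁ (t₀ + 2) le_rfl (by omega)
  -- the terminal: a regime-R σ-state is never isolated, but the virtual state is
  exact not_isIsolated_of_regimeR_sigma hlm hlu hlf hmu hmf huf p hσ hn hdn hr1e hRe (hpk (t₀ + 2) (by omega)).2.2.2.2.2.2.2.2.1

end ResCone

end Summit.ResolutionOfSingularities.ResolutionOfSingularities.Theorems.PIDim4
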